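import Summits.ValiantsHypothesis.ValiantsHypothesis.Theses.LangWeilTransfer
import Summits.ValiantsHypothesis.ValiantsHypothesis.Theorems.LangWeilTransferShatteringExclusionComponentDescent
import Literature.Computability.AlgebraicComplexity.ArithCircuitProofs

/-!
# DRAFT (not registered) — a possible `birth` v3 for crux `ShatteringExclusion` (stmt-ValiantsHypothesis-6372)

Written by the line's lead prover (val-width-6372-p1 g2, 2026-08-28) for the director / tenure planner; it
is NOT skeleton-checked and registers nothing.  It records, in kernel-checked form, the "regularity"
reading of the line's bet that the session's data support (`Cruxes/ShatteringExclusion/RyserGlynnRigidity.md`: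
15 explicit honest circuits — per_2, per_3 naive, Ryser per_3/4/5, Glynn per_3/4, Berkowitz det_2..5,
Karatsuba, Gauss, Strassen, four Waring configurations — all have their constant vector on EXACTLY ONE
component of the constants variety; no crossing at any honest circuit):

* `stub_lowDegreeMinimal` (LDC-min, open-problem grade, ≥ `stub_lowDegreeConstants` in strength): if
  `per_n` has circuits of size `≤ n^c`, then some SIZE-MINIMAL fan-in-two circuit for `per_n` (size
  `= L_ℂ(per_n)`) has all constants in a number field of degree `≤ n^{d₀}`.
* `stub_minimalUnibranch` (MinimalCircuitsUnibranch for the permanent, conjecture grade; the universal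
  version "every size-minimal fan-in-two circuit for every polynomial has its constant vector on exactly one
  component of its constants variety" is the research question `MinimalCircuitsRegular` of census P2): for
  large `n`, the constant vector of every size-minimal circuit for `per_n` lies on exactly one irreducible
  component of the complexified constants variety.
* the landed descent `stub_componentDescent` (p572771), used by name;
* `ShatteringExclusion_of_v3` — the composition (`c' = c` since the minimal size is `≤ n^c`).

Trade-off versus v2 (`LowDegreeConstants ∧ FewBranches`): v3 moves the existential "rewiring" out of the
structural stub (B becomes a universal statement about minimal circuits, testable on small cases and
supported by all data so far) at the price of strengthening the arithmetic stub (A must deliver low-degree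
constants ON A MINIMAL SHAPE).  Both residuals remain open-problem / conjecture grade; VP ≠ VNP is NOT
moved by anything here.
-/

set_option linter.dupNamespace false

namespace Summit.ValiantsHypothesis.ValiantsHypothesis.Cruxes.ShatteringExclusion.BirthV3Draft

open Summit.ValiantsHypothesis.ValiantsHypothesis.Theses.LangWeilTransfer
open Literature.Computability.AlgebraicComplexity
open Literature.Computability.AlgebraicComplexity.ArithCircuit

/-- **LDC-min** (candidate stub A, open-problem grade): low-degree constants on a size-minimal shape.
[open-problem grade: Burgisser2000 Ch. 4; ≥ `stub_lowDegreeConstants`] -/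
def LowDegreeMinimal : Prop :=
  ∀ c : ℕ, ∃ d₀ N : ℕ, ∀ n ≥ N,
    (∃ P : ArithCircuit ℂ (Fin n × Fin n),
        P.IsFanInTwo ∧ P.size ≤ n ^ c ∧ P.Computes (perPoly (Fin n) ℂ)) →
      ∃ P : ArithCircuit ℂ (Fin n × Fin n),
        P.IsFanInTwo ∧ P.size = complexity (perPoly (Fin n) ℂ) ∧ P.Computes (perPoly (Fin n) ℂ) ∧
          ∃ K : IntermediateField ℚ ℂ, FiniteDimensional ℚ K ∧ Module.finrank ℚ K ≤ n ^ d₀ ∧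
            ∀ v : Fin (4 * P.size + 1), slotConst P v ∈ K

/-- **MinimalCircuitsUnibranch (permanent)** (candidate stub B, conjecture grade; supported by the
session's data on 15 explicit circuits, kernel-checked for `per_2`): the constant vector of a size-minimal
circuit for `per_n` lies on exactly one irreducible component of its complexified constants variety.
[conjecture grade; nearest prior art: arXiv:2606.18440 (full parameters of layered PNNs give smooth
points), Shahverdi–Marchetti–Kohn (singularities ⇐ sub-networks)] -/
def MinimalUnibranch : Prop :=
  ∃ N : ℕ, ∀ n ≥ N, ∀ P : ArithCircuit ℂ (Fin n × Fin n),
    P.IsFanInTwo → P.Computes (perPoly (Fin n) ℂ) → P.size = complexity (perPoly (Fin n) ℂ) →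
      ∃! 𝔓 : Ideal (MvPolynomial (Fin (4 * P.size + 1)) ℂ),
        𝔓 ∈ ((Ideal.span (Set.range fun α : (Fin n × Fin n) →₀ ℕ =>
          MvPolynomial.map (Int.castRingHom ℚ) (MvPolynomial.coeff α
            (MvPolynomial.sumAlgEquiv ℤ (Fin n × Fin n) (Fin (4 * P.size + 1)) (skeleton P).eval) -
            MvPolynomial.C (MvPolynomial.coeff α (perPoly (Fin n) ℤ))))).map
          (MvPolynomial.map (algebraMap ℚ ℂ))).minimalPrimes ∧
        𝔓 ≤ RingHom.ker (MvPolynomial.aeval (fun v : Fin (4 * P.size + 1) => slotConst P v) :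
          MvPolynomial (Fin (4 * P.size + 1)) ℂ →ₐ[ℂ] ℂ)

/-- Candidate stub A (signature = `LowDegreeMinimal` verbatim). [open-problem grade] -/
theorem stub_lowDegreeMinimal :
    ∀ c : ℕ, ∃ d₀ N : ℕ, ∀ n ≥ N,
      (∃ P : ArithCircuit ℂ (Fin n × Fin n),
          P.IsFanInTwo ∧ P.size ≤ n ^ c ∧ P.Computes (perPoly (Fin n) ℂ)) →
        ∃ P : ArithCircuit ℂ (Fin n × Fin n),
          P.IsFanInTwo ∧ P.size = complexity (perPoly (Fin n) ℂ) ∧ P.Computes (perPoly (Fin n) ℂ) ∧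
            ∃ K : IntermediateField ℚ ℂ, FiniteDimensional ℚ K ∧ Module.finrank ℚ K ≤ n ^ d₀ ∧
              ∀ v : Fin (4 * P.size + 1), slotConst P v ∈ K := by
  sorry

/-- Candidate stub B (signature = `MinimalUnibranch` verbatim). [conjecture grade] -/
theorem stub_minimalUnibranch :
    ∃ N : ℕ, ∀ n ≥ N, ∀ P : ArithCircuit ℂ (Fin n × Fin n),
      P.IsFanInTwo → P.Computes (perPoly (Fin n) ℂ) → P.size = complexity (perPoly (Fin n) ℂ) →
        ∃! 𝔓 : Ideal (MvPolynomial (Fin (4 * P.size + 1)) ℂ),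
          𝔓 ∈ ((Ideal.span (Set.range fun α : (Fin n × Fin n) →₀ ℕ =>
            MvPolynomial.map (Int.castRingHom ℚ) (MvPolynomial.coeff α
              (MvPolynomial.sumAlgEquiv ℤ (Fin n × Fin n) (Fin (4 * P.size + 1)) (skeleton P).eval) -
              MvPolynomial.C (MvPolynomial.coeff α (perPoly (Fin n) ℤ))))).map
            (MvPolynomial.map (algebraMap ℚ ℂ))).minimalPrimes ∧
          𝔓 ≤ RingHom.ker (MvPolynomial.aeval (fun v : Fin (4 * P.size + 1) => slotConst P v) :
            MvPolynomial (Fin (4 * P.size + 1)) ℂ →ₐ[ℂ] ℂ) := by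
  sorry

/-- **Composition (v3)**: LDC-min gives a size-minimal circuit with constants of degree `≤ n^{d₀}`
(its size `L(per_n)` is `≤ n^c` by `complexity_le_size`), MinimalUnibranch puts its constant vector on a
unique component, and the landed descent (`…ComponentDescent.stub_componentDescent`, p572771) yields a
minimal prime with `≤ n^{d₀}` geometric components: SE with `c' = c`. [folklore] -/
theorem ShatteringExclusion_of_v3 :
    LowDegreeMinimal → MinimalUnibranch → ShatteringExclusion := by
  intro hA hB c
  obtain ⟨d₀, N₁, hA'⟩ := hA c
  obtain ⟨N₂, hB'⟩ := hB
  refine ⟨c, d₀, max N₁ N₂, fun n hn hP => ?_⟩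
  obtain ⟨P₀, hP₀2, hP₀s, hP₀c⟩ := hP
  obtain ⟨P, hP2, hPs, hPc, K, hKfd, hKrk, hKmem⟩ :=
    hA' n (le_trans (le_max_left N₁ N₂) hn) ⟨P₀, hP₀2, hP₀s, hP₀c⟩
  have hsize : P.size ≤ n ^ c := by
    rw [hPs]; exact (complexity_le_size hP₀2 hP₀c).trans hP₀s
  have huniq := hB' n (le_trans (le_max_right N₁ N₂) hn) P hP2 hPc hPs
  exact ⟨P, hP2, hsize, hPc, _, rfl,
    Summit.ValiantsHypothesis.ValiantsHypothesis.Theorems.LangWeilTransfer.ShatteringExclusion.stub_componentDescent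
      (4 * P.size + 1) (n ^ d₀) _ (fun v : Fin (4 * P.size + 1) => slotConst P v) K hKfd hKrk hKmem huniq⟩

end Summit.ValiantsHypothesis.ValiantsHypothesis.Cruxes.ShatteringExclusion.BirthV3Draft
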